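import Literature.Geometry.Riemannian.SphericalCylinderEntropy
import Literature.Geometry.Riemannian.SphericalZonalFourPositivity
import Literature.Geometry.Riemannian.SphericalZonalKernelSeriesDeriv
import Literature.MeasureTheory.Hausdorff.SphereHausdorffFinite
import Mathlib.Geometry.Euclidean.Volume.Measure
import HarnessLib

/-!
# Stub K3 `stub_sliceDensity` of line `ball-mass-slack` (crux `ThinCrossSectionExists`, stmt-SmoothPoincare4-7633)

The typed slice-normalised Gaussian density of the unit slice `slice₀ = S⁴ × {0} ⊂ N = S⁴ × ℝ ⊂ ℝ⁶` at a centre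
`p ∈ N` and scale `τ > 0` is the Gaussian height factor,

  `F̂_{p,τ}(slice₀) = e^{-p₅²/4τ}`,

GIVEN the zonal mass identity `∫_{S⁴} 𝔥(τ, ⟨x,u⟩) dμHE⁴(x) = μHE⁴(S⁴)` (stub K2 `stub_zonalSphereIntegral`, taken here as
the hypothesis, verbatim).  This is the registered signature `stub_sliceDensity` of the lead-1 skeleton
`Cruxes/ThinCrossSectionExists/Lines/ball_mass_slack.lean` (sha `fa8f6255…`), proved by measure plumbing only:

* `lintegral_slice₀_eq_lintegral_sphere` — isometric transfer `slice₀ ≅ S⁴ ⊂ ℝ⁵`: for measurable `G`,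
  `∫⁻ z in slice₀, G z dμH⁴ = ∫⁻ y in S⁴, G (padL y) dμH⁴` (`Isometry.map_hausdorffMeasure` for `sliceMap 0` and for the
  sphere inclusion, `lintegral_map`);
* `ratio_hausdorff_eq_ratio_euclideanHausdorff` — `μHE⁴ = c • μH⁴` on `ℝ⁵` with `c ≠ 0`, so normalised integrals agree:
  `(μH⁴ S⁴)⁻¹ ∫⁻_{S⁴} f dμH⁴ = (μHE⁴ S⁴)⁻¹ ∫⁻_{S⁴} f dμHE⁴`;
* `lintegral_ofReal_zonal_sphere` — `lintegral ↔ integral` for the continuous, non-negative (on the sphere) integrand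
  `y ↦ 𝔥(τ, ∑ yᵢuᵢ)`, turning K2's real identity into `∫⁻_{S⁴} ofReal 𝔥 dμHE⁴ = μHE⁴(S⁴)`;
* `stub_sliceDensity` — on `slice₀` the Gaussian factor of the typed kernel is the constant `e^{-p₅²/4τ}`; pull it out.

Pure proofs over tree vocabulary (`cylDensity`, `cylKernel`, `zonal`, `sliceMap`, `padL`) and Mathlib's `μHE`; no definitions,
no facts.  Seat: prover-line-stmt-SmoothPoincare4-7633-c1-0 (shadowing lead-1's wave; `--supports stmt-SmoothPoincare4-7633`).
-/

noncomputable section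

open scoped BigOperators Topology ENNReal NNReal MeasureTheory
open Set Function MeasureTheory
open Literature.Geometry.Riemannian.SphericalCylinderEntropy (cylEntropy cylDensity cylKernel zonal gegen wt
  cylKernel_eq isometry_sliceMap hausdorffMeasure_sphere_four_pos hausdorffMeasure_sphere_four_lt_top
  truncL truncL_apply)
open Literature.Geometry.Riemannian.SphericalZonalKernelSeries (zonal_nonneg continuous_zonal)
open Literature.Geometry.Manifold.CylinderSlice (sliceMap range_sliceMap sliceMap_apply_castSucc
  sliceMap_apply_last sum_sq_eq_one padL padL_apply_castSucc padL_apply_last axis)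

set_option linter.dupNamespace false

namespace Summit.SmoothPoincare4.SmoothPoincare4.Theorems.ThinCrossSectionExists.BallMassSlack

namespace SliceDensity

/-- `sliceMap 0` is `padL` after the sphere inclusion. [folklore] -/
theorem sliceMap_zero_apply (x : Metric.sphere (0 : EuclideanSpace ℝ (Fin 5)) 1) : sliceMap 0 x = padL (x : EuclideanSpace ℝ (Fin 5)) := by
  simp [sliceMap]

/-- **Isometric transfer `slice₀ ≅ S⁴`.**  For a measurable `G : ℝ⁶ → ℝ≥0∞`,
`∫⁻ z in S⁴×{0}, G z dμH⁴ = ∫⁻ y in S⁴, G (padL y) dμH⁴` (`sliceMap 0` and the sphere inclusion are isometries, and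
isometries push `μH⁴` forward to `μH⁴` restricted to their range). [folklore] -/
theorem lintegral_slice₀_eq_lintegral_sphere {G : EuclideanSpace ℝ (Fin 6) → ℝ≥0∞} (hG : Measurable G) :
    ∫⁻ z in Set.range (sliceMap 0), G z ∂μH[4] = ∫⁻ y in (Metric.sphere (0 : EuclideanSpace ℝ (Fin 5)) 1), G (padL y) ∂μH[4] := by
  have h1 : (μH[4] : Measure (EuclideanSpace ℝ (Fin 6))).restrict (Set.range (sliceMap 0)) =
      Measure.map (sliceMap 0) (μH[4] : Measure (Metric.sphere (0 : EuclideanSpace ℝ (Fin 5)) 1)) :=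
    ((isometry_sliceMap 0).map_hausdorffMeasure (Or.inl (by norm_num))).symm
  have h2 : (μH[4] : Measure (EuclideanSpace ℝ (Fin 5))).restrict (Metric.sphere (0 : EuclideanSpace ℝ (Fin 5)) 1) =
      Measure.map (Subtype.val : Metric.sphere (0 : EuclideanSpace ℝ (Fin 5)) 1 → EuclideanSpace ℝ (Fin 5)) (μH[4] : Measure (Metric.sphere (0 : EuclideanSpace ℝ (Fin 5)) 1)) := by
    rw [(isometry_subtype_coe (s := (Metric.sphere (0 : EuclideanSpace ℝ (Fin 5)) 1))).map_hausdorffMeasure (Or.inl (by norm_num)),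
      Subtype.range_coe]
  have hm : Measurable fun y : EuclideanSpace ℝ (Fin 5) => G (padL y) := hG.comp padL.continuous.measurable
  rw [h1, h2, lintegral_map hG (isometry_sliceMap 0).continuous.measurable,
    lintegral_map hm continuous_subtype_val.measurable]
  simp only [sliceMap_zero_apply]

/-- `μHE⁴ = c • μH⁴` on `ℝ⁵` for a non-zero finite constant `c` (Mathlib's normalisation of `μHE`). [folklore] -/
theorem exists_euclideanHausdorff_eq_smul :
    ∃ c : ℝ≥0, c ≠ 0 ∧ (μHE[4] : Measure (EuclideanSpace ℝ (Fin 5))) = c • (μH[4] : Measure (EuclideanSpace ℝ (Fin 5))) := by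
  refine ⟨_, Measure.addHaarScalarFactor_volume_hausdorffMeasure_ne_zero 4, ?_⟩
  have h := Measure.euclideanHausdorffMeasure_def (X := EuclideanSpace ℝ (Fin 5)) 4
  refine h.trans ?_
  congr 1

/-- `μHE⁴(S⁴) ≠ 0` in `ℝ⁵`. [folklore] -/
theorem euclideanHausdorff_sphere_ne_zero : (μHE[4] : Measure (EuclideanSpace ℝ (Fin 5))) (Metric.sphere (0 : EuclideanSpace ℝ (Fin 5)) 1) ≠ 0 := by
  obtain ⟨c, hc0, hdef⟩ := exists_euclideanHausdorff_eq_smul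
  rw [hdef, Measure.smul_apply, ENNReal.smul_def, smul_eq_mul]
  exact mul_ne_zero (ENNReal.coe_ne_zero.2 hc0) hausdorffMeasure_sphere_four_pos.ne'

/-- `μHE⁴(S⁴) < ⊤` in `ℝ⁵`. [folklore] -/
theorem euclideanHausdorff_sphere_lt_top : (μHE[4] : Measure (EuclideanSpace ℝ (Fin 5))) (Metric.sphere (0 : EuclideanSpace ℝ (Fin 5)) 1) < ⊤ :=
  Literature.MeasureTheory.Hausdorff.euclideanHausdorffMeasure_sphere_lt_top (E := EuclideanSpace ℝ (Fin 5)) (d := 4)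
    (by rw [finrank_euclideanSpace_fin]) 1

/-- **`μH`-normalised and `μHE`-normalised sphere integrals agree**: `μHE⁴ = c • μH⁴` on `ℝ⁵` with `c ≠ 0, ⊤`, and the
constant cancels in the ratio. [folklore] -/
theorem ratio_hausdorff_eq_ratio_euclideanHausdorff (s : Set (EuclideanSpace ℝ (Fin 5))) (f : EuclideanSpace ℝ (Fin 5) → ℝ≥0∞) :
    (μH[4] s)⁻¹ * ∫⁻ y in s, f y ∂μH[4] =
      ((μHE[4] : Measure (EuclideanSpace ℝ (Fin 5))) s)⁻¹ * ∫⁻ y in s, f y ∂(μHE[4] : Measure (EuclideanSpace ℝ (Fin 5))) := by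
  obtain ⟨c, hc, hdef⟩ := exists_euclideanHausdorff_eq_smul
  have hc0 : (c : ℝ≥0∞) ≠ 0 := ENNReal.coe_ne_zero.2 hc
  have hctop : (c : ℝ≥0∞) ≠ ⊤ := ENNReal.coe_ne_top
  rw [hdef, setLIntegral_smul_measure, Measure.smul_apply, ENNReal.smul_def, ENNReal.smul_def, smul_eq_mul,
    smul_eq_mul, ENNReal.mul_inv (Or.inl hc0) (Or.inl hctop), mul_mul_mul_comm,
    ENNReal.inv_mul_cancel hc0 hctop, one_mul]

/-- Points of the sphere (as a set) satisfy `∑ᵢ yᵢ² = 1`. [folklore] -/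
theorem sum_sq_eq_one_of_mem {y : EuclideanSpace ℝ (Fin 5)} (hy : y ∈ (Metric.sphere (0 : EuclideanSpace ℝ (Fin 5)) 1)) : ∑ i : Fin 5, y i ^ 2 = 1 :=
  sum_sq_eq_one ⟨y, hy⟩

/-- On the sphere the zonal argument `∑ yᵢ uᵢ` lies in `[-1, 1]` for a unit `u`, so `𝔥(τ, ·) ≥ 0` there. [folklore] -/
theorem zonal_sum_nonneg {τ : ℝ} (hτ : 0 < τ) {u : EuclideanSpace ℝ (Fin 5)} (hu : ∑ i : Fin 5, u i ^ 2 = 1) {y : EuclideanSpace ℝ (Fin 5)}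
    (hy : y ∈ (Metric.sphere (0 : EuclideanSpace ℝ (Fin 5)) 1)) : 0 ≤ zonal τ (∑ i : Fin 5, y i * u i) := by
  have h := Finset.sum_mul_sq_le_sq_mul_sq Finset.univ (fun i : Fin 5 => y i) (fun i : Fin 5 => u i)
  simp only [sum_sq_eq_one_of_mem hy, hu, mul_one] at h
  have habs : |∑ i : Fin 5, y i * u i| ≤ 1 := by
    rw [← sq_le_one_iff_abs_le_one]; exact h
  exact zonal_nonneg hτ _ ⟨by linarith [neg_abs_le (∑ i : Fin 5, y i * u i)], (le_abs_self _).trans habs⟩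

/-- The integrand `y ↦ 𝔥(τ, ∑ yᵢ uᵢ)` is continuous (`τ > 0`). [folklore] -/
theorem continuous_zonal_sum {τ : ℝ} (hτ : 0 < τ) (u : EuclideanSpace ℝ (Fin 5)) :
    Continuous fun y : EuclideanSpace ℝ (Fin 5) => zonal τ (∑ i : Fin 5, y i * u i) := by
  refine (continuous_zonal hτ).comp ?_
  fun_prop

/-- **`lintegral ↔ integral` for the zonal integrand.**  Given K2's real identity at `(τ, u)`,
`∫⁻_{S⁴} ofReal 𝔥(τ, ∑ yᵢuᵢ) dμHE⁴ = μHE⁴(S⁴)` (continuous, non-negative on the sphere, finite measure). [folklore] -/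
theorem lintegral_ofReal_zonal_sphere {τ : ℝ} (hτ : 0 < τ) {u : EuclideanSpace ℝ (Fin 5)} (hu : ∑ i : Fin 5, u i ^ 2 = 1)
    (hK2 : ∫ x in (Metric.sphere (0 : EuclideanSpace ℝ (Fin 5)) 1), zonal τ (∑ i : Fin 5, x i * u i) ∂(μHE[4] : Measure (EuclideanSpace ℝ (Fin 5))) =
      ((μHE[4] : Measure (EuclideanSpace ℝ (Fin 5))) (Metric.sphere (0 : EuclideanSpace ℝ (Fin 5)) 1)).toReal) :
    ∫⁻ y in (Metric.sphere (0 : EuclideanSpace ℝ (Fin 5)) 1), ENNReal.ofReal (zonal τ (∑ i : Fin 5, y i * u i)) ∂(μHE[4] : Measure (EuclideanSpace ℝ (Fin 5))) =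
      (μHE[4] : Measure (EuclideanSpace ℝ (Fin 5))) (Metric.sphere (0 : EuclideanSpace ℝ (Fin 5)) 1) := by
  have hcont := continuous_zonal_sum hτ u
  obtain ⟨M, hM⟩ := (isCompact_sphere (0 : EuclideanSpace ℝ (Fin 5)) 1).exists_bound_of_continuousOn hcont.continuousOn
  have hint : IntegrableOn (fun y : EuclideanSpace ℝ (Fin 5) => zonal τ (∑ i : Fin 5, y i * u i)) (Metric.sphere (0 : EuclideanSpace ℝ (Fin 5)) 1)
      (μHE[4] : Measure (EuclideanSpace ℝ (Fin 5))) :=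
    Measure.integrableOn_of_bounded (M := M) euclideanHausdorff_sphere_lt_top.ne hcont.aestronglyMeasurable
      ((ae_restrict_iff' Metric.isClosed_sphere.measurableSet).2 (ae_of_all _ fun y hy => hM y hy))
  have hnn : 0 ≤ᵐ[(μHE[4] : Measure (EuclideanSpace ℝ (Fin 5))).restrict (Metric.sphere (0 : EuclideanSpace ℝ (Fin 5)) 1)]
      fun y : EuclideanSpace ℝ (Fin 5) => zonal τ (∑ i : Fin 5, y i * u i) :=
    (ae_restrict_iff' Metric.isClosed_sphere.measurableSet).2
      (ae_of_all _ fun y hy => zonal_sum_nonneg hτ hu hy)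
  rw [← ofReal_integral_eq_lintegral_ofReal hint hnn, hK2,
    ENNReal.ofReal_toReal euclideanHausdorff_sphere_lt_top.ne]

end SliceDensity

open SliceDensity

/-- **STUB K3 (`stub_sliceDensity`) of line `ball-mass-slack`, proved.**  Given the zonal mass identity on the round
`S⁴` (stub K2, as the hypothesis), the typed slice-normalised density of the unit slice `S⁴ × {0}` at every centre `p ∈ N`
and scale `τ > 0` is `F̂_{p,τ}(slice₀) = e^{-p₅²/4τ}`: on the slice the Gaussian factor of the typed kernel is the constant
`e^{-p₅²/4τ}`, the remaining `μH⁴`-integral of `𝔥(τ, ⟨z', p'⟩)` over `S⁴ × {0}` is transferred isometrically to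
`S⁴ ⊂ ℝ⁵`, renormalised from `μH⁴` to `μHE⁴`, and equals `μHE⁴(S⁴)` by K2, cancelling the normalisation. [folklore] -/
theorem stub_sliceDensity :
    (∀ τ : ℝ, 0 < τ → ∀ u : EuclideanSpace ℝ (Fin 5), ∑ i : Fin 5, u i ^ 2 = 1 →
      ∫ x in Metric.sphere (0 : EuclideanSpace ℝ (Fin 5)) 1, zonal τ (∑ i : Fin 5, x i * u i) ∂μHE[4] =
        (μHE[4] (Metric.sphere (0 : EuclideanSpace ℝ (Fin 5)) 1)).toReal) →
    ∀ p : EuclideanSpace ℝ (Fin 6), ∑ i : Fin 5, p (Fin.castSucc i) ^ 2 = 1 → ∀ τ : ℝ, 0 < τ →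
      cylDensity {z : EuclideanSpace ℝ (Fin 6) | ∑ i : Fin 5, z (Fin.castSucc i) ^ 2 = 1 ∧ z 5 = 0} p τ =
        ENNReal.ofReal (Real.exp (-((p 5) ^ 2) / (4 * τ))) := by
  intro hK2 p hp τ hτ
  -- the unit vector `u = p'` fed to K2
  set u : EuclideanSpace ℝ (Fin 5) := truncL p with hu_def
  have hu_apply : ∀ i : Fin 5, u i = p (Fin.castSucc i) := fun i => truncL_apply p i
  have hu : ∑ i : Fin 5, u i ^ 2 = 1 := by simp only [hu_apply]; exact hp
  -- the integrand on `S⁴ ⊂ ℝ⁵` after transfer, and the Gaussian height factor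
  set G' : EuclideanSpace ℝ (Fin 5) → ℝ≥0∞ := fun y => ENNReal.ofReal (zonal τ (∑ i : Fin 5, y i * u i)) with hG'_def
  have hG'm : Measurable G' := (ENNReal.continuous_ofReal.comp (continuous_zonal_sum hτ u)).measurable
  set C : ℝ≥0∞ := ENNReal.ofReal (Real.exp (-((p 5) ^ 2) / (4 * τ))) with hC_def
  -- Step 1: the slice is the range of the isometry `sliceMap 0`
  have hslice : {z : EuclideanSpace ℝ (Fin 6) | ∑ i : Fin 5, z (Fin.castSucc i) ^ 2 = 1 ∧ z 5 = 0} = Set.range (sliceMap 0) :=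
    (range_sliceMap 0).symm
  -- Step 2: the typed kernel at `padL y`, `y ∈ S⁴`: zonal part times the constant Gaussian factor
  have hker : ∀ y ∈ (Metric.sphere (0 : EuclideanSpace ℝ (Fin 5)) 1), ENNReal.ofReal (cylKernel p τ (padL y)) = G' y * C := by
    intro y hy
    have harg : ∑ i : Fin 5, padL y (Fin.castSucc i) * p (Fin.castSucc i) = ∑ i : Fin 5, y i * u i := by
      simp only [padL_apply_castSucc, hu_apply]
    rw [cylKernel_eq, harg, padL_apply_last, zero_sub, neg_sq, hG'_def, hC_def,
      ENNReal.ofReal_mul (zonal_sum_nonneg hτ hu hy)]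
  have hmeasK : Measurable fun z : EuclideanSpace ℝ (Fin 6) => ENNReal.ofReal (cylKernel p τ z) := by
    refine ENNReal.measurable_ofReal.comp (Continuous.measurable ?_)
    show Continuous fun z : EuclideanSpace ℝ (Fin 6) => zonal τ (∑ i : Fin 5, z (Fin.castSucc i) * p (Fin.castSucc i)) *
      Real.exp (-((z 5 - p 5) ^ 2) / (4 * τ))
    exact ((continuous_zonal hτ).comp (by fun_prop)).mul (by fun_prop)
  -- Step 3: transfer to `S⁴ ⊂ ℝ⁵` and pull the constant out
  have htransfer : ∫⁻ z in Set.range (sliceMap 0), ENNReal.ofReal (cylKernel p τ z) ∂μH[4] =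
      (∫⁻ y in (Metric.sphere (0 : EuclideanSpace ℝ (Fin 5)) 1), G' y ∂μH[4]) * C := by
    rw [lintegral_slice₀_eq_lintegral_sphere hmeasK, ← lintegral_mul_const _ hG'm]
    exact setLIntegral_congr_fun Metric.isClosed_sphere.measurableSet hker
  -- Step 4: assemble
  show (μH[4] (Metric.sphere (0 : EuclideanSpace ℝ (Fin 5)) 1))⁻¹ *
      ∫⁻ z in {z : EuclideanSpace ℝ (Fin 6) | ∑ i : Fin 5, z (Fin.castSucc i) ^ 2 = 1 ∧ z 5 = 0},
        ENNReal.ofReal (cylKernel p τ z) ∂μH[4] = C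
  rw [hslice, htransfer, ← mul_assoc, ratio_hausdorff_eq_ratio_euclideanHausdorff, hG'_def,
    lintegral_ofReal_zonal_sphere hτ hu (hK2 τ hτ u hu),
    ENNReal.inv_mul_cancel euclideanHausdorff_sphere_ne_zero euclideanHausdorff_sphere_lt_top.ne, one_mul]

end Summit.SmoothPoincare4.SmoothPoincare4.Theorems.ThinCrossSectionExists.BallMassSlack

end
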